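import Literature.MathematicalPhysics.QuantumFieldTheory.Balaban1983to89.B9CoReadingCoordsTranspose
import Literature.MathematicalPhysics.QuantumFieldTheory.Balaban1983to89.B9CoReadingCoordsS

/-!
# `Balaban1983to89.B9CoReadingCoordsDir` — the SINGLE-DIRECTION coordinate letters `∇_{U,μ}`, `∇*_{U,μ}` of the κ-fold coordinate model (bond and site
# sectors): the pins for n06-k's direction letters `DirOps310 ∕ DirOps37`, their functoriality with the letter models, and `DirTranspose…` at the pins

T. Bałaban, *Propagators for lattice gauge theories in a background field*, Commun. Math. Phys. **99** (1985) 389–434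
[`Balaban1985BackgroundPropagators`, "B9"]; [4] = T. Bałaban, *Propagators and renormalization transformations for lattice gauge
theories. II*, Commun. Math. Phys. **96** (1984) 223–250 [`Balaban1984PropagatorsII`].

statement-level skeleton of published theorems with citation tags; proofs where landed; nothing here is a claim about the
Yang–Mills mass gap

THE PRINTED LOCI.  (3.3)/(3.8) pp. 390–392 (`∇_{U,μ}`, `∇*_{U,μ}`), (3.46) p. 398 (the second-order members `∇_U∇_UG`, `∇_UG∇*_U`, `G∇*_U∇*_U` over
ALL direction pairs), p. 391 (*"∇*_U … the adjoint of ∇_U"*).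

THE POINT.  `B9CoReadingCoords` models `∇_U` on the κ-fold carrier `S × Fin (d+1) × κ × κ` SLOT-WISE (`DcoK = coordOpK b (ν ↦ ∇_{U,ν})`: slot `ν` gets
direction `ν`), so its composites only see the DIAGONAL direction pairs — the located point (O4′) of n06-k g8.  The (3.46) members ₃,₄,₅ and the (3.44)∕(3.45)
readings need, per direction `μ`, the letter `∇_{U,μ}` acting in EVERY slot: THIS FILE defines these single-direction letters (bond sector `DdK ∕ DsdK`, site
sector `DdS ∕ DsdS` with the `η⁻¹` prefactor of `B9CoReadingCoordsS`), proves their functoriality with the letter models (so that n06-k's pair families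
`familyOp (q ↦ (Dd q.1 ∘ₗ Dd q.2) ∘ₗ G)`, `familyOp (q ↦ G ∘ₗ (Dsd q.1 ∘ₗ Dsd q.2))`, `familyOp (q ↦ (Dd q.1 ∘ₗ G) ∘ₗ Dsd q.2)` become ONE `coordOpK` of a genuine
composite per pair), and proves n06-k's schema `DirTranspose310 ∕ 37` AT THE PINS for unitary-valued `U` over the orthonormal trace basis
(`B9CoReadingCoordsTranspose`, (3.8)).
* §1 bond sector: `DdK`, `DsdK`, `DdK_comp_coordOpK`, `coordOpK_comp_DsdK`, `DdK_DdK_comp_GcoK`, `GcoK_comp_DsdK_DsdK`, `DdK_GcoK_DsdK`,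
  ★ `isTransposePair_DsdK_DdK` (orthonormal `b`, unitary-valued `cfg U`; with `B9CoReadingCoordsTranspose.trBasis_repr_eq_trace` no basis hypothesis remains);
* §2 site sector: `DdS`, `DsdS`, the same functoriality with `GcoS`.
HONEST SCOPE.  Finite-dimensional bookkeeping; nothing of [B9] asserted; count-neutral; N06 NOT discharged; one finite lattice programme at fixed ε; nothing continuum
∕ ℝ⁴ ∕ OS ∕ mass gap ∕ Clay.  Cell `pub-ymgap` (D-0062), node N06 [B9], seat `pub-ymgap-dag-n06-d` (g5), 2026-08-27.
-/

noncomputable section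

namespace Literature.MathematicalPhysics.QuantumFieldTheory.Balaban1983to89.B9CoReadingCoordsDir

open B6KLevelCensusIndexV1 (KIdx)
open B9Thm37Glue (IsTransposePair)
open B9Thm37GlueTorusCov (isTransposePair_smul)
open B9Thm39ReadingCoords (cR39)
open B9CoReadingCoords (coordOpK coordOpK_comp cdBₗ cdsBₗ cdBₗ_apply cdsBₗ_apply XBK GcoK)
open B9CoReadingCoordsS (XSK GcoS)
open B9Ineq349SiteComposite (cdSL cdsSL etaS_pos)
open B9CoReadingCoordsTranspose (trReForm trReForm_symm trReForm_apply isTransposePair_coordOpK_of_adjoint sum_trReForm_cdB)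
open Node00 (SiteY FBondY IBondY CfgY BondOpY SiteOpY etaS)
open scoped Matrix

variable {d ℓ : ℕ} {hd : 1 ≤ d + 1} {hL : Odd (ℓ + 1) ∧ 1 < ℓ + 1} {b₀ b₁ : ℝ}
variable {𝔸 : Type} [NormedRing 𝔸] [NormedAlgebra ℂ 𝔸] [CompleteSpace 𝔸]
variable {κ : Type} [Fintype κ] [DecidableEq κ]

/-! ## §1 Bond sector -/

section Bond

variable (i : KIdx d ℓ hd hL b₀ b₁) (b : Module.Basis κ ℝ 𝔸) [FiniteDimensional ℝ 𝔸] (B : B9.Backgrounds) (cfg : B.Cfg → CfgY 𝔸 i)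

/-- ★ **THE SINGLE-DIRECTION LETTER `∇_{U,μ}`** on the bond carrier: direction `μ` in EVERY slot (the pin for n06-k's `DirOps310.Dd U μ`).
[cite: Balaban1985BackgroundPropagators, (3.3) p.390 + (3.46) p.398] -/
def DdK (U₁ : B.Cfg) (μ : Fin (d + 1)) : (XBK κ i → ℝ) →ₗ[ℝ] (XBK κ i → ℝ) := coordOpK b (fun _ : Fin (d + 1) => cdBₗ i (cfg U₁) μ)

/-- ★ **THE SINGLE-DIRECTION LETTER `∇*_{U,μ}`** on the bond carrier (the pin for `DirOps310.Dsd U μ`). [cite: Balaban1985BackgroundPropagators, (3.8) p.392 + (3.46) p.398] -/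
def DsdK (U₁ : B.Cfg) (μ : Fin (d + 1)) : (XBK κ i → ℝ) →ₗ[ℝ] (XBK κ i → ℝ) := coordOpK b (fun _ : Fin (d + 1) => cdsBₗ i (cfg U₁) μ)

variable (O : BondOpY 𝔸 i) (U₁ : B.Cfg)

omit [DecidableEq κ] in
/-- `∇_{U,μ}∇_{U,ν}G(U)` per pair IS one coordinate model. [cite: Balaban1985BackgroundPropagators, (3.46) p.398 (fifth member), bookkeeping] -/
theorem DdK_DdK_comp_GcoK (μ ν : Fin (d + 1)) :
    (DdK i b B cfg U₁ μ ∘ₗ DdK i b B cfg U₁ ν) ∘ₗ GcoK i b B cfg O U₁ =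
      cR39 b • coordOpK b (fun _ : Fin (d + 1) => cdBₗ i (cfg U₁) μ ∘ₗ cdBₗ i (cfg U₁) ν ∘ₗ (O (cfg U₁)).restrictScalars ℝ) := by
  rw [DdK, DdK, GcoK, coordOpK_comp, LinearMap.comp_smul, coordOpK_comp]; rfl

omit [DecidableEq κ] in
/-- `G(U)∇*_{U,μ}∇*_{U,ν}` per pair IS one coordinate model. [cite: Balaban1985BackgroundPropagators, (3.46) p.398 (sixth member), bookkeeping] -/
theorem GcoK_comp_DsdK_DsdK (μ ν : Fin (d + 1)) :
    GcoK i b B cfg O U₁ ∘ₗ (DsdK i b B cfg U₁ μ ∘ₗ DsdK i b B cfg U₁ ν) =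
      cR39 b • coordOpK b (fun _ : Fin (d + 1) => (O (cfg U₁)).restrictScalars ℝ ∘ₗ (cdsBₗ i (cfg U₁) μ ∘ₗ cdsBₗ i (cfg U₁) ν)) := by
  rw [DsdK, DsdK, GcoK, coordOpK_comp, LinearMap.smul_comp, coordOpK_comp]

omit [DecidableEq κ] in
/-- the MIXED member `∇_{U,μ}G(U)∇*_{U,ν}` per pair IS one coordinate model (all pairs reachable — the cure side of (O4′)).
[cite: Balaban1985BackgroundPropagators, (3.46) p.398 (fourth member), bookkeeping] -/
theorem DdK_GcoK_DsdK (μ ν : Fin (d + 1)) :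
    (DdK i b B cfg U₁ μ ∘ₗ GcoK i b B cfg O U₁) ∘ₗ DsdK i b B cfg U₁ ν =
      cR39 b • coordOpK b (fun _ : Fin (d + 1) => (cdBₗ i (cfg U₁) μ ∘ₗ (O (cfg U₁)).restrictScalars ℝ) ∘ₗ cdsBₗ i (cfg U₁) ν) := by
  rw [DdK, DsdK, GcoK, LinearMap.comp_smul, coordOpK_comp, LinearMap.smul_comp, coordOpK_comp]

omit [DecidableEq κ] in
/-- `∇_{U,μ}G(U)` (one direction, every slot). [cite: Balaban1985BackgroundPropagators, (3.44)–(3.46) p.398, bookkeeping] -/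
theorem DdK_comp_GcoK (μ : Fin (d + 1)) :
    DdK i b B cfg U₁ μ ∘ₗ GcoK i b B cfg O U₁ = cR39 b • coordOpK b (fun _ : Fin (d + 1) => cdBₗ i (cfg U₁) μ ∘ₗ (O (cfg U₁)).restrictScalars ℝ) := by
  rw [DdK, GcoK, LinearMap.comp_smul, coordOpK_comp]

omit [DecidableEq κ] in
/-- `G(U)∇*_{U,ν}` (one direction, every slot). [cite: Balaban1985BackgroundPropagators, (3.44)–(3.46) p.398, bookkeeping] -/
theorem GcoK_comp_DsdK (ν : Fin (d + 1)) :
    GcoK i b B cfg O U₁ ∘ₗ DsdK i b B cfg U₁ ν = cR39 b • coordOpK b (fun _ : Fin (d + 1) => (O (cfg U₁)).restrictScalars ℝ ∘ₗ cdsBₗ i (cfg U₁) ν) := by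
  rw [DsdK, GcoK, LinearMap.smul_comp, coordOpK_comp]

end Bond

/-! ## §2 `DirTranspose310` at the pins: `∇*_{U,μ}` is the transpose of `∇_{U,μ}` for unitary-valued `U` over an orthonormal trace basis -/

section BondTranspose

open scoped Matrix.Norms.L2Operator

variable {N : ℕ} (i : KIdx d ℓ hd hL b₀ b₁) (b : Module.Basis κ ℝ (Matrix (Fin N) (Fin N) ℂ)) (B : B9.Backgrounds)
  (cfg : B.Cfg → CfgY (Matrix (Fin N) (Fin N) ℂ) i) (U₁ : B.Cfg)

omit [DecidableEq κ] in
/-- ★ **`DirTranspose310` AT THE PINS**: `IsTransposePair (DsdK … μ) (DdK … μ)` for an orthonormal trace basis `b` and unitary-valued `cfg U`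
((3.8) for the sesquilinear trace pairing, `B9CoReadingCoordsTranspose.sum_trReForm_cdB`). [cite: Balaban1985BackgroundPropagators, (3.8) p.392 + p.391] -/
theorem isTransposePair_DsdK_DdK (hb : ∀ (v : Matrix (Fin N) (Fin N) ℂ) (c : κ), b.repr v c = (Matrix.trace ((b c)ᴴ * v)).re)
    (hU : ∀ μ x, ((cfg U₁ μ x : (Matrix (Fin N) (Fin N) ℂ)ˣ) : Matrix (Fin N) (Fin N) ℂ) ∈ unitary (Matrix (Fin N) (Fin N) ℂ)) (μ : Fin (d + 1)) :
    IsTransposePair (DsdK i b B cfg U₁ μ) (DdK i b B cfg U₁ μ) := by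
  unfold DsdK DdK
  refine isTransposePair_coordOpK_of_adjoint b trReForm trReForm_symm (fun v c => by rw [hb, trReForm_apply]) _ _ fun ν Φ Ψ => ?_
  simp only [cdBₗ_apply, cdsBₗ_apply]
  -- `Σ β(Ψ, ∇*Φ) = Σ β(∇Ψ, Φ)`: the (3.8) identity read with the symmetric pairing
  have h := sum_trReForm_cdB i (cfg U₁) hU μ Ψ Φ
  calc ∑ x, trReForm (Ψ x) (Node00.cdsB i (cfg U₁) μ Φ x) = ∑ x, trReForm (Node00.cdsB i (cfg U₁) μ Φ x) (Ψ x) :=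
        Finset.sum_congr rfl fun x _ => trReForm_symm _ _
    _ = ∑ x, trReForm (Φ x) (Node00.cdB i (cfg U₁) μ Ψ x) := (sum_trReForm_cdB i (cfg U₁) hU μ Ψ Φ).symm
    _ = ∑ x, trReForm (Node00.cdB i (cfg U₁) μ Ψ x) (Φ x) := Finset.sum_congr rfl fun x _ => trReForm_symm _ _

end BondTranspose

/-! ## §3 Site sector -/

section Site

variable (i : KIdx d ℓ hd hL b₀ b₁) (b : Module.Basis κ ℝ 𝔸) [FiniteDimensional ℝ 𝔸] (B : B9.Backgrounds) (cfg : B.Cfg → CfgY 𝔸 i)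

/-- ★ the single-direction letter `∇_{U,μ}` on the SITE carrier, prefactor `η⁻¹` (pin for `DirOps37.Dd U μ`). [cite: Balaban1985BackgroundPropagators, (3.3) p.390 + (3.46) p.398] -/
def DdS (U₁ : B.Cfg) (μ : Fin (d + 1)) : (XSK κ i → ℝ) →ₗ[ℝ] (XSK κ i → ℝ) :=
  (etaS i)⁻¹ • coordOpK b (fun _ : Fin (d + 1) => (cdSL i (cfg U₁) μ).restrictScalars ℝ)

/-- ★ the single-direction letter `∇*_{U,μ}` on the SITE carrier, prefactor `η⁻¹` (pin for `DirOps37.Dsd U μ`). [cite: Balaban1985BackgroundPropagators, (3.8) p.392 + (3.46) p.398] -/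
def DsdS (U₁ : B.Cfg) (μ : Fin (d + 1)) : (XSK κ i → ℝ) →ₗ[ℝ] (XSK κ i → ℝ) :=
  (etaS i)⁻¹ • coordOpK b (fun _ : Fin (d + 1) => (cdsSL i (cfg U₁) μ).restrictScalars ℝ)

variable (O : SiteOpY 𝔸 i) (U₁ : B.Cfg)

omit [DecidableEq κ] in
/-- `∇_{U,μ}∇_{U,ν}G′(U)` per pair IS one coordinate model, prefactor `cR39`. [cite: Balaban1985BackgroundPropagators, (3.46) p.398, bookkeeping] -/
theorem DdS_DdS_comp_GcoS (μ ν : Fin (d + 1)) :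
    (DdS i b B cfg U₁ μ ∘ₗ DdS i b B cfg U₁ ν) ∘ₗ GcoS i b B cfg O U₁ =
      cR39 b • coordOpK b (fun _ : Fin (d + 1) =>
        (cdSL i (cfg U₁) μ).restrictScalars ℝ ∘ₗ (cdSL i (cfg U₁) ν).restrictScalars ℝ ∘ₗ (O (cfg U₁)).restrictScalars ℝ) := by
  simp only [DdS, GcoS, LinearMap.smul_comp, LinearMap.comp_smul, smul_smul, coordOpK_comp]
  congr 1
  rw [pow_two]; field_simp [(etaS_pos i).ne']

omit [DecidableEq κ] in
/-- `G′(U)∇*_{U,μ}∇*_{U,ν}` per pair IS one coordinate model, prefactor `cR39`. [cite: Balaban1985BackgroundPropagators, (3.46) p.398, bookkeeping] -/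
theorem GcoS_comp_DsdS_DsdS (μ ν : Fin (d + 1)) :
    GcoS i b B cfg O U₁ ∘ₗ (DsdS i b B cfg U₁ μ ∘ₗ DsdS i b B cfg U₁ ν) =
      cR39 b • coordOpK b (fun _ : Fin (d + 1) =>
        (O (cfg U₁)).restrictScalars ℝ ∘ₗ ((cdsSL i (cfg U₁) μ).restrictScalars ℝ ∘ₗ (cdsSL i (cfg U₁) ν).restrictScalars ℝ)) := by
  simp only [DsdS, GcoS, LinearMap.smul_comp, LinearMap.comp_smul, smul_smul, coordOpK_comp]
  congr 1
  rw [pow_two]; field_simp [(etaS_pos i).ne']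

omit [DecidableEq κ] in
/-- the MIXED member `∇_{U,μ}G′(U)∇*_{U,ν}` per pair IS one coordinate model, prefactor `cR39`. [cite: Balaban1985BackgroundPropagators, (3.46) p.398, bookkeeping] -/
theorem DdS_GcoS_DsdS (μ ν : Fin (d + 1)) :
    (DdS i b B cfg U₁ μ ∘ₗ GcoS i b B cfg O U₁) ∘ₗ DsdS i b B cfg U₁ ν =
      cR39 b • coordOpK b (fun _ : Fin (d + 1) =>
        ((cdSL i (cfg U₁) μ).restrictScalars ℝ ∘ₗ (O (cfg U₁)).restrictScalars ℝ) ∘ₗ (cdsSL i (cfg U₁) ν).restrictScalars ℝ) := by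
  simp only [DdS, DsdS, GcoS, LinearMap.smul_comp, LinearMap.comp_smul, smul_smul, coordOpK_comp]
  congr 1
  rw [pow_two]; field_simp [(etaS_pos i).ne']

end Site

end Literature.MathematicalPhysics.QuantumFieldTheory.Balaban1983to89.B9CoReadingCoordsDir

end
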